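import Literature.Probability.RandomPlanarGeometry.HexSAWRotStripSurfaceBridgeNull
import Literature.Probability.RandomPlanarGeometry.HexSAWRotStripLateralNullYHolds
import HarnessLib

/-!
# «ROT-BY-SQUEEZE» Beaton's rotated strip below and at the critical surface fugacity: the two-sided squeeze
# `c_B(y)·B_{H+1}(x_c; y) ≤ 2cos(π/16)·B_H(x_c; 1) ≤ (c_B(y) + κ·B_H(x_c; 1))·B_{H+1}(x_c; y)`, the ratio law with an explicit
# rate, locality of the arch classes in `y`, and the jump of the top class AT `y = y†`

Topic `Literature/Probability/RandomPlanarGeometry` — the rotated-frame twin of the tree's `HexSAWStripSurfaceBridgeSqueeze` (the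
Duminil-Copin–Smirnov-frame squeeze of BBdGDCG's §4.5 display).  Continues `HexSAWRotStripSurfaceBridgeNull` (the tree's UPPER half:
`HV.rotTopY_succ_le`, `HV.iSup_rotTopY_succ_le : c_B(y)·B_{H+1}(x_c; y) ≤ 2cos(π/16)·B_H(x_c; 1)`, `HV.tendsto_iSup_rotTopY_zero`,
`HV.iSup_rotTopY_le_log`) with the `y`-identity `HV.rotStrip_identityY` (Proposition 6 at `n = 0`, `HexSAWRotStripIdentityY`), the
last-contact cut `HV.rot_arch_cut_iSup` (`HexSAWRotStripArchCut`), the critical infinite-strip identity `HV.rotStrip_identity_lim` and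
`HV.iSup_rotStripBR_pos` (`HexSAWRotStripLateralNull`), the lateral-null law `HV.rotELimZeroY_holds` (`HexSAWRotStripLateralNullYHolds`)
and T3 `HV.iSup_rotStripBR_le_log`, `HV.tendsto_iSup_rotStripBR` (`HexSAWRotStripLogDecay`, `HexSAWRotSurfaceFugacity`).
Source: N. R. Beaton, *The critical surface fugacity of self-avoiding walks on a rotated honeycomb lattice*, J. Phys. A 47 (2014) 075003,
arXiv:1210.0274v3, §4: the identity (21) and its `L → ∞` limit (22) (p. 16), (23), Lemma 12, Corollary 13 and Proposition 11
(p. 17), the PROOF of Proposition 11 (p. 18: the last-contact cut of Fig. 7, the displays (24), "c_B B_T(x,1) − c_B(y)B_{T+1}(x,y) ≤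
(c^O_A + c^I_A + c_P) B_{T+1}(x,y) B_T(x,1)", (25) "0 ≤ 1/B_{T+1}(x,y) ≤ (c^O_A + c^I_A + c_P)/c_B + c_B(y)/(c_B B_T(x,1))" and (26)),
and Appendix A, Corollary 15 (p. 19: `lim_T B_T(x_c, 1) = 0`); p. 16: "c_B(y) is a continuous and monotone decreasing function of y for
y > 0, and … c_B(y†) = 0 where y† = …".

## What is proved (lane «pcv-sawmu», seat a-idea-1 gen 25, door 7 «ROT-BY-SQUEEZE», lens «bridge decompositions with explicit rates»;
## every statement PROVED — no `sorry`, no new axioms, no new definitions; imports: tree only ⇒ CLASS S)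

Print uses (24)–(26) only qualitatively and only ABOVE `y†` ("take `T → ∞`, contradiction": Proposition 11, in the tree as
`HV.rotStripByUnbounded_holds`); the tree's `HexSAWRotStripSurfaceBridgeNull` has the one-row UPPER bound below `y†`.  This file types
the printed one-step display itself, BELOW `y†`, as the missing LOWER bound, and reads the two halves together:

* § 1–2 `rotStrip_identityY_coeff`, `rotClsY_le`, `tendsto_rotClsY_width`, `tendsto_rotTopY_width`, ★ `rotStrip_identityY_lim` — Beaton's
  (22) at general `0 < y < y†` in the infinite strip: `c^O_A A^O_H(y) + c^I_A A^I_H(y) + c_B(y) B_H(y) + c_P P_H(y) = 2x_c cos(π/16)`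
  (every class converges along the widths by monotonicity + the identity bound; the lateral class dies by the lane's interpolation law);
* § 3 `rot_arch_cut_lim` — (24) class by class in the infinite strip: `0 ≤ A^O_{H+1}(y) − A^O_H(1) ≤ x_c⁻¹ B_{H+1}(y) B_H(1)` (same for
  `A^I`, `P`); `rot_one_step_defect_eq` / `rot_one_step_defect_bounds` — the printed display AS PRINTED (tree normalisation):
  **`0 ≤ 2cos(π/16)·B_H(x_c;1) − c_B(y)·B_{H+1}(x_c;y) ≤ σ x_c⁻¹ · B_{H+1}(x_c;y) · B_H(x_c;1)`**, `σ := 2sin(3π/16) + 2sin(π/16) + 2cos(7π/16)`;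
* § 4 ★ `two_mul_cos_mul_iSup_rotStripBR_le_mul` (the LOWER half), `iSup_rotTopY_succ_ge` (`B_{H+1}(x_c;y) > 0` with the explicit floor
  `2cos(π/16) B_H(1)/(c_B(y) + σ x_c⁻¹ B_H(1))`), `inv_iSup_rotTopY_succ_le` (= (25) as printed), the RATIO LAW
  ★ **`abs_ratio_sub_rotBcoeff_le : |2cos(π/16)·B_H(x_c;1)/B_{H+1}(x_c;y) − c_B(y)| ≤ σ x_c⁻¹ · B_H(x_c;1)`** (`0 < y < y†`, `H ≥ 1`), at the
  tree's rate `abs_ratio_sub_rotBcoeff_le_log : … ≤ C (log H)^{−1/3}` (`H ≥ 2`), hence `tendsto_ratio_rotBcoeff` and the asymptotic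
  equivalence ★ `tendsto_iSup_rotTopY_succ_div : B_{H+1}(x_c;y)/B_H(x_c;1) → 2cos(π/16)/c_B(y)` — below `y†` the surface fugacity enters the
  top class of a high strip only through the printed factor `2cos(π/16)/c_B(y)`;
* § 5 `rot_arch_growth_le_sq`, `tendsto_rot_arch_growth_zero` — LOCALITY of the arch classes: the weighted one-step growth
  `Σ c·[X_{H+1}(y) − X_H(1)]` is `≤ (2cos(π/16))² σ x_c⁻¹/c_B(y) · B_H(x_c;1)²` and `→ 0`;
* § 6 ★ **`exists_lt_rotTopY_succ_rotYdagger`** — AT `y = y†`, for EVERY `H ≥ 1` and every `j < j₀ := 2cos(π/16)·x_c/σ` (`= 0.5612…`,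
  `rot_jump_const_gt_half : j₀ > 1/2`) some width has `B^{→}_{H+1,W}(x_c; y†) > j`; `exists_half_lt_rotTopY_succ_rotYdagger`,
  `rotTopY_jump_at_rotYdagger` — the JUMP: below `y†` every width's top class is eventually `< ε`, at `y†` some width's exceeds `1/2` at
  every height `H ≥ 2` (print would need the STRICT inequality `y† < y_{T+1}` to read (25) at `y†`; the limit `y ↑ y†` with the
  monotonicity of `B^{→}_{H+1,W}(x_c; ·)` sidesteps it — no finiteness of `sup_W B^{→}_{H+1,W}(x_c; y†)` is claimed).

NORMALISATION (token RY-2, as in `HexSAWRotStripThresholdRate`): `B_H(x_c; 1) = ⨆_W HV.rotStripBR H W` and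
`B_{H+1}(x_c; y) = ⨆_W HV.rotGFy (D(H+1, W)) (H+1) IsRotTopDart y` are the tree's RIGHT-STARTED HALVES `B^{→}` of Beaton's symmetric classes
(printed `B_T = 2·B^{→}`, printed right-hand side `c_G = 2x_c cos(π/16)` kept); the cut constant is `x_c⁻¹` (tree `rot_arch_cut_iSup`) where
print has `(1+x)/2 ≤ 1` against the symmetric classes — so `σ x_c⁻¹` here plays the rôle of print's `(c^O_A + c^I_A + c_P)`, and RATIOS
(`B_H(1)/B_{H+1}(y)`, the constant `2cos(π/16)/c_B(y)`) are normalisation-free.  Objects: `c_B(y) = HV.rotBcoeff y` (`rotBcoeff_eq_bracket`: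
it IS the bracket of Proposition 6), `y† = HV.rotYdagger`, `x_c = hexCriticalFugacity`.

Label (author's reading, for lit-1/lit-2 to decide): § 1–4 CONSOLIDATION of Beaton (22)–(25) for `0 < y < y†` typed as printed (the
lower half and (25) are in print, used there only for `y > y†` by contradiction); the ratio law with explicit error, the asymptotic
equivalence, the locality bound and the jump constant `j₀ > 1/2` AT `y†` are lane corollaries NOT stated in print (NEW-IN-WRITING, XS–S).
References: [Beaton14] as above; [DCS12] H. Duminil-Copin, S. Smirnov, Ann. Math. 175 (2012) 1653–1665 (x_c, the parafermionic identity);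
[GM19] A. Glazman, I. Manolescu, arXiv:1708.00395, Proposition 1.1 (tree `HexSAWBridgeLogDecay`, the `(log H)^{−1/3}` rate);
[BBdGDCG14] arXiv:1109.0358v5 §4.5 (the parallel-frame display this mirrors).
Edition 2 (a-idea-1 gen 25): lit-1 g18 tokens RS-1–RS-4 folded (arXiv id of [GM19]; page/line locators of three docstrings) — docstrings only, code verbatim.
-/

noncomputable section

open Finset Filter Topology

namespace Literature.Probability.RandomPlanarGeometry.SAW.HV

/-! ### 0. Admissible widths; Beaton's top coefficient `c_B(y)` is `≥ 0` up to `y†`, vanishes there, continuously -/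

/-- Above every width there is an ADMISSIBLE one (`W' ≥ 1`, `H + W'` odd — the parity under which Beaton's identities hold on `D(H, W')`).
[cite: Beaton2014RotatedHoneycomb, §2.2 (arXiv v3 p. 5: the domain D_{T,L}) and Proposition 6 with Fig. 4 (p. 9: "we require T + L ≡ 1 (mod 2)")] -/
theorem exists_rot_admissible_width (H Wd : ℕ) : ∃ W' : ℕ, Wd ≤ W' ∧ 1 ≤ W' ∧ Odd (H + W') := by
  rcases Nat.even_or_odd (H + (Wd + 1)) with h | h
  · exact ⟨Wd + 2, by omega, by omega, by rw [show H + (Wd + 2) = H + (Wd + 1) + 1 by ring]; exact h.add_one⟩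
  · exact ⟨Wd + 1, by omega, by omega, h⟩

/-- The bracket of Proposition 6 at `n = 0` IS `c_B(y) = rotBcoeff y` (closed form `rotB_coeff_eq`).
[cite: Beaton2014RotatedHoneycomb, Proposition 6 (arXiv v3 p. 9) and §4 eq. (21) (p. 16: the definition of c_B(y))] -/
theorem rotBcoeff_eq_bracket {y : ℝ} (hy : 0 < y) :
    2 * (Real.cos (Real.pi / 16) -
        ((1 - hexCriticalFugacity * y - hexCriticalFugacity ^ 2 * y ^ 2) * Real.cos (17 * Real.pi / 16) +
            hexCriticalFugacity ^ 2 * y ^ 2 * Real.cos (5 * Real.pi / 16)) /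
          (hexCriticalFugacity * y * (1 + hexCriticalFugacity * y))) = rotBcoeff y := by
  rw [rotB_coeff_eq hy]; rfl

/-- `c_B(y) ≥ 0` for `0 < y ≤ y†`. [cite: Beaton2014RotatedHoneycomb, §4 (arXiv v3 p. 16: "c_B(y) is a continuous and monotone decreasing function of y for y > 0, and … c_B(y†) = 0")] -/
theorem rotBcoeff_nonneg {y : ℝ} (hy : 0 < y) (hle : y ≤ rotYdagger) : 0 ≤ rotBcoeff y := by
  have hx : 0 < hexCriticalFugacity := hexCriticalFugacity_pos_lt_one.1
  have hnum : 0 ≤ Real.cos (Real.pi / 16) - hexCriticalFugacity ^ 2 * y ^ 2 * Real.cos (5 * Real.pi / 16) := by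
    rcases hle.lt_or_eq with h | h
    · exact ((rotB_coeff_pos_iff hy).1.2 h).le
    · exact ((rotB_coeff_pos_iff hy).2.2 h).ge
  unfold rotBcoeff
  positivity

/-- `c_B(y†) = 0`. [cite: Beaton2014RotatedHoneycomb, §4 (arXiv v3 p. 16: "c_B(y†) = 0 where y† = …")] -/
theorem rotBcoeff_rotYdagger : rotBcoeff rotYdagger = 0 := by
  have h : Real.cos (Real.pi / 16) - hexCriticalFugacity ^ 2 * rotYdagger ^ 2 * Real.cos (5 * Real.pi / 16) = 0 :=
    (rotB_coeff_pos_iff rotYdagger_pos).2.2 rfl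
  unfold rotBcoeff
  rw [h, zero_div, mul_zero]

/-- `c_B` is continuous at every `y > 0` (a rational function whose denominator `x_c y (1 + x_c y)` does not vanish).
[cite: Beaton2014RotatedHoneycomb, §4 (arXiv v3 p. 16: "c_B(y) is a continuous … function of y for y > 0")] -/
theorem continuousAt_rotBcoeff {y : ℝ} (hy : 0 < y) : ContinuousAt rotBcoeff y := by
  have hx : 0 < hexCriticalFugacity := hexCriticalFugacity_pos_lt_one.1
  have hden : hexCriticalFugacity * y * (1 + hexCriticalFugacity * y) ≠ 0 := by positivity
  unfold rotBcoeff
  exact continuousAt_const.mul ((by fun_prop : ContinuousAt (fun y : ℝ => Real.cos (Real.pi / 16) -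
      hexCriticalFugacity ^ 2 * y ^ 2 * Real.cos (5 * Real.pi / 16)) y).div (by fun_prop) hden)

/-- **`c_B(y) → 0 = c_B(y†)` as `y ↑ y†`.** [cite: Beaton2014RotatedHoneycomb, §4 (arXiv v3 p. 16: c_B continuous, c_B(y†) = 0)] -/
theorem tendsto_rotBcoeff_rotYdagger : Tendsto rotBcoeff (𝓝[<] rotYdagger) (𝓝 0) := by
  have h := (continuousAt_rotBcoeff rotYdagger_pos).tendsto
  rw [rotBcoeff_rotYdagger] at h
  exact h.mono_left nhdsWithin_le_nhds

/-! ### 1. Proposition 6 with the named coefficient; a priori bounds of the arch classes up to `y†`; width limits -/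

/-- Beaton's identity (21) on `D(H, W) ∖ {a⁻}` (`H, W ≥ 1`, `H + W` odd, `y > 0`) with the top coefficient written `c_B(y) = rotBcoeff y`:
`2sin(3π/16)·A^O + 2sin(π/16)·A^I + 2cos(3π/16)·E + c_B(y)·B + 2cos(7π/16)·P = 2 x_c cos(π/16)` (the tree's `rotStrip_identityY` —
Proposition 6 at `n = 0` — after `rotB_coeff_eq`).  NORMALISATION: all classes are the tree's RIGHT-STARTED halves at `x = x_c` with weight
`x_c^{ℓ} y^{contacts}`; print's symmetric `B_T = 2·B^{→}`, `c_G = 2·(2 x_c cos(π/16))`.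
[cite: Beaton2014RotatedHoneycomb, Proposition 6 (arXiv v3 p. 9) and §4 eq. (21) (p. 16)] -/
theorem rotStrip_identityY_coeff {H Wd : ℕ} (hH : 1 ≤ H) (hW : 1 ≤ Wd) (hodd : Odd (H + Wd)) {y : ℝ} (hy : 0 < y) :
    2 * Real.sin (3 * Real.pi / 16) * rotGFy ((rotStripV H Wd).erase wOut) H IsRotBotOut y +
      2 * Real.sin (Real.pi / 16) * rotGFy ((rotStripV H Wd).erase wOut) H IsRotBotIn y +
      2 * Real.cos (3 * Real.pi / 16) * rotGFy ((rotStripV H Wd).erase wOut) H (IsRotLatDart H Wd) y +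
      rotBcoeff y * rotGFy ((rotStripV H Wd).erase wOut) H (IsRotTopDart H) y +
      2 * Real.cos (7 * Real.pi / 16) * rotGFy ((rotStripV H Wd).erase wOut) H IsRotCloseDart y =
    2 * hexCriticalFugacity * Real.cos (Real.pi / 16) := by
  rw [← rotBcoeff_eq_bracket hy]
  exact rotStrip_identityY hH hW hodd hy

/-- **A priori bounds up to AND INCLUDING `y†`**: for `H ≥ 1`, every width `W` and `0 < y ≤ y†`, the three arch-type classes of
`D(H, W) ∖ {a⁻}` obey `2sin(3π/16)·A^O_{H,W}(x_c; y) ≤ 2 x_c cos(π/16)`, `2sin(π/16)·A^I_{H,W}(x_c; y) ≤ 2 x_c cos(π/16)`,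
`2cos(7π/16)·P_{H,W}(x_c; y) ≤ 2 x_c cos(π/16)` (the identity at an admissible width `W' ≥ W`, all other terms `≥ 0` since `c_B(y) ≥ 0`;
then monotonicity in the width). [cite: Beaton2014RotatedHoneycomb, §4 (arXiv v3 p. 16: "For 0 < y < y†, every term in (21) is non-negative"; p. 17: the classes "are all bounded by this identity", Lemma 12)] -/
theorem rotClsY_le {H : ℕ} (hH : 1 ≤ H) (Wd : ℕ) {y : ℝ} (hy : 0 < y) (hle : y ≤ rotYdagger) :
    2 * Real.sin (3 * Real.pi / 16) * rotGFy ((rotStripV H Wd).erase wOut) H IsRotBotOut y ≤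
        2 * hexCriticalFugacity * Real.cos (Real.pi / 16) ∧
      2 * Real.sin (Real.pi / 16) * rotGFy ((rotStripV H Wd).erase wOut) H IsRotBotIn y ≤
        2 * hexCriticalFugacity * Real.cos (Real.pi / 16) ∧
      2 * Real.cos (7 * Real.pi / 16) * rotGFy ((rotStripV H Wd).erase wOut) H IsRotCloseDart y ≤
        2 * hexCriticalFugacity * Real.cos (Real.pi / 16) := by
  obtain ⟨cO, cI, cE, cP, -⟩ := rot_coeff_pos
  obtain ⟨W', hWW', hW'1, hodd⟩ := exists_rot_admissible_width H Wd
  have hid := rotStrip_identityY_coeff hH hW'1 hodd hy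
  have hsub : (rotStripV H Wd).erase wOut ⊆ (rotStripV H W').erase wOut := erase_subset_erase _ (rotStripV_mono_width hWW')
  have mO := rotGFy_mono hsub H IsRotBotOut hy.le
  have mI := rotGFy_mono hsub H IsRotBotIn hy.le
  have mP := rotGFy_mono hsub H IsRotCloseDart hy.le
  have nO := rotGFy_nonneg ((rotStripV H W').erase wOut) H IsRotBotOut hy.le
  have nI := rotGFy_nonneg ((rotStripV H W').erase wOut) H IsRotBotIn hy.le
  have nE := rotGFy_nonneg ((rotStripV H W').erase wOut) H (IsRotLatDart H W') hy.le
  have nB := rotGFy_nonneg ((rotStripV H W').erase wOut) H (IsRotTopDart H) hy.le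
  have nP := rotGFy_nonneg ((rotStripV H W').erase wOut) H IsRotCloseDart hy.le
  have hc := rotBcoeff_nonneg hy hle
  have h1 := mul_nonneg cO.le nO
  have h2 := mul_nonneg cI.le nI
  have h3 := mul_nonneg cE.le nE
  have h4 := mul_nonneg hc nB
  have h5 := mul_nonneg cP.le nP
  exact ⟨by nlinarith [mul_le_mul_of_nonneg_left mO cO.le], by nlinarith [mul_le_mul_of_nonneg_left mI cI.le],
    by nlinarith [mul_le_mul_of_nonneg_left mP cP.le]⟩

/-- A width-independent `y`-weighted class of `D(H, ·)` (`y ≥ 0`) bounded through a positive coefficient is non-decreasing in the width and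
converges to its supremum (the `y`-weighted twin of the tree's `tendsto_rotGF_width`).
[cite: Beaton2014RotatedHoneycomb, §4 (arXiv v3 p. 16: "A^O_{T,L}, A^I_{T,L}, B_{T,L} and P_{T,L} actually increase with L … and so they have the same limits")] -/
theorem tendsto_rotGFy_width (H : ℕ) (cls : HV × HV → Prop) [DecidablePred cls] {y : ℝ} (hy : 0 ≤ y) {c K : ℝ} (hc : 0 < c)
    (hle : ∀ Wd : ℕ, c * rotGFy ((rotStripV H Wd).erase wOut) H cls y ≤ K) :
    BddAbove (Set.range fun Wd : ℕ => rotGFy ((rotStripV H Wd).erase wOut) H cls y) ∧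
      Tendsto (fun Wd : ℕ => rotGFy ((rotStripV H Wd).erase wOut) H cls y) atTop
        (𝓝 (⨆ Wd : ℕ, rotGFy ((rotStripV H Wd).erase wOut) H cls y)) := by
  have hbdd : BddAbove (Set.range fun Wd : ℕ => rotGFy ((rotStripV H Wd).erase wOut) H cls y) := by
    refine ⟨K / c, ?_⟩
    rintro _ ⟨Wd, rfl⟩
    rw [le_div_iff₀ hc, mul_comm]
    exact hle Wd
  exact ⟨hbdd, tendsto_atTop_ciSup (fun a b hab => rotGFy_mono (erase_subset_erase _ (rotStripV_mono_width hab)) H cls hy) hbdd⟩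

/-- The three arch-type classes at `0 < y ≤ y†` (`H ≥ 1`): bounded in the width, and convergent to their suprema
`A^O_H(x_c; y) := ⨆_W A^O_{H,W}(x_c; y)`, `A^I_H(x_c; y)`, `P_H(x_c; y)` — Beaton's `A^O_T(x, y) := lim_{L → ∞} A^O_{T,L}(x, y)` & co.
[cite: Beaton2014RotatedHoneycomb, §4 (arXiv v3 p. 16: the definition A^O_T(x,y) := lim_L A^O_{T,L}(x,y) and "they have the same limits")] -/
theorem tendsto_rotClsY_width {H : ℕ} (hH : 1 ≤ H) {y : ℝ} (hy : 0 < y) (hle : y ≤ rotYdagger) :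
    (BddAbove (Set.range fun Wd : ℕ => rotGFy ((rotStripV H Wd).erase wOut) H IsRotBotOut y) ∧
      Tendsto (fun Wd : ℕ => rotGFy ((rotStripV H Wd).erase wOut) H IsRotBotOut y) atTop
        (𝓝 (⨆ Wd : ℕ, rotGFy ((rotStripV H Wd).erase wOut) H IsRotBotOut y))) ∧
    (BddAbove (Set.range fun Wd : ℕ => rotGFy ((rotStripV H Wd).erase wOut) H IsRotBotIn y) ∧
      Tendsto (fun Wd : ℕ => rotGFy ((rotStripV H Wd).erase wOut) H IsRotBotIn y) atTop
        (𝓝 (⨆ Wd : ℕ, rotGFy ((rotStripV H Wd).erase wOut) H IsRotBotIn y))) ∧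
    (BddAbove (Set.range fun Wd : ℕ => rotGFy ((rotStripV H Wd).erase wOut) H IsRotCloseDart y) ∧
      Tendsto (fun Wd : ℕ => rotGFy ((rotStripV H Wd).erase wOut) H IsRotCloseDart y) atTop
        (𝓝 (⨆ Wd : ℕ, rotGFy ((rotStripV H Wd).erase wOut) H IsRotCloseDart y))) := by
  obtain ⟨cO, cI, -, cP, -⟩ := rot_coeff_pos
  exact ⟨tendsto_rotGFy_width H IsRotBotOut hy.le cO fun Wd => (rotClsY_le hH Wd hy hle).1,
    tendsto_rotGFy_width H IsRotBotIn hy.le cI fun Wd => (rotClsY_le hH Wd hy hle).2.1,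
    tendsto_rotGFy_width H IsRotCloseDart hy.le cP fun Wd => (rotClsY_le hH Wd hy hle).2.2⟩

/-- The `y`-weighted top class below `y†`: bounded in the width (tree `rotGFy_top_le`, Lemma 12) and convergent to
`B_H(x_c; y) := ⨆_W B^{→}_{H,W}(x_c; y)`. [cite: Beaton2014RotatedHoneycomb, §4, Lemma 12 (arXiv v3 p. 17)] -/
theorem tendsto_rotTopY_width {H : ℕ} (hH : 1 ≤ H) {y : ℝ} (hy : 0 < y) (hlt : y < rotYdagger) :
    BddAbove (Set.range fun Wd : ℕ => rotGFy ((rotStripV H Wd).erase wOut) H (IsRotTopDart H) y) ∧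
      Tendsto (fun Wd : ℕ => rotGFy ((rotStripV H Wd).erase wOut) H (IsRotTopDart H) y) atTop
        (𝓝 (⨆ Wd : ℕ, rotGFy ((rotStripV H Wd).erase wOut) H (IsRotTopDart H) y)) := by
  have hbdd : BddAbove (Set.range fun Wd : ℕ => rotGFy ((rotStripV H Wd).erase wOut) H (IsRotTopDart H) y) :=
    ⟨_, by rintro _ ⟨Wd, rfl⟩; exact rotGFy_top_le hH hy hlt Wd⟩
  exact ⟨hbdd, tendsto_atTop_ciSup (rotGFy_top_monotone H hy.le) hbdd⟩

/-! ### 2. Beaton's identity (23) in the infinite strip, for `0 < y < y†` -/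

/-- **The infinite-strip identity with surface fugacity (Beaton's (23)), for `0 < y < y†` and every height `H ≥ 1`**:
`2sin(3π/16)·A^O_H(x_c; y) + 2sin(π/16)·A^I_H(x_c; y) + c_B(y)·B_H(x_c; y) + 2cos(7π/16)·P_H(x_c; y) = 2 x_c cos(π/16)`, the four
classes being the width suprema (= limits, § 1).  Print: "(22) … then gives `c^O_A A^O_T(x,y) + c^I_A A^I_T(x,y) + c_P P_T(x,y) + c_B(y) B_T(x,y)
= c_G` (23)", stated for `0 ≤ y < y_T`; here for `y < y† ≤ y_T` (Lemma 12), where every input is unconditional in the tree: the finite identity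
`rotStrip_identityY`, the top bound `rotGFy_top_le` (Lemma 12) and the vanishing of the lateral class `rotELimZeroY_holds` (Corollary 13,
the lane's slab-summability proof) — the limit is taken along the admissible widths `W ≡ H + 1 (mod 2)`.
[cite: Beaton2014RotatedHoneycomb, §4, eq. (22)–(23) and Corollary 13 (arXiv v3 pp. 16–17)] -/
theorem rotStrip_identityY_lim {H : ℕ} (hH : 1 ≤ H) {y : ℝ} (hy : 0 < y) (hlt : y < rotYdagger) :
    2 * Real.sin (3 * Real.pi / 16) * (⨆ Wd : ℕ, rotGFy ((rotStripV H Wd).erase wOut) H IsRotBotOut y) +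
      2 * Real.sin (Real.pi / 16) * (⨆ Wd : ℕ, rotGFy ((rotStripV H Wd).erase wOut) H IsRotBotIn y) +
      rotBcoeff y * (⨆ Wd : ℕ, rotGFy ((rotStripV H Wd).erase wOut) H (IsRotTopDart H) y) +
      2 * Real.cos (7 * Real.pi / 16) * (⨆ Wd : ℕ, rotGFy ((rotStripV H Wd).erase wOut) H IsRotCloseDart y) =
    2 * hexCriticalFugacity * Real.cos (Real.pi / 16) := by
  obtain ⟨⟨-, tO⟩, ⟨-, tI⟩, ⟨-, tP⟩⟩ := tendsto_rotClsY_width hH hy hlt.le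
  obtain ⟨-, tB⟩ := tendsto_rotTopY_width hH hy hlt
  have tE := rotELimZeroY_holds hH hy.le (fun Wd => rotGFy_top_le hH hy hlt Wd)
  -- the admissible widths `W m := 2m + 1 + (H mod 2)`
  set W : ℕ → ℕ := fun m => 2 * m + 1 + H % 2 with hWdef
  have hW1 : ∀ m, 1 ≤ W m := fun m => by simp only [hWdef]; omega
  have hWodd : ∀ m, Odd (H + W m) := fun m => by
    simp only [hWdef]; rw [Nat.odd_iff]; omega
  have hW : Tendsto W atTop atTop :=
    tendsto_atTop_mono (fun m => by show m ≤ 2 * m + 1 + H % 2; omega) tendsto_id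
  have lhs := ((((tO.comp hW).const_mul (2 * Real.sin (3 * Real.pi / 16))).add
    ((tI.comp hW).const_mul (2 * Real.sin (Real.pi / 16)))).add
    ((tE.comp hW).const_mul (2 * Real.cos (3 * Real.pi / 16)))).add
    ((tB.comp hW).const_mul (rotBcoeff y)) |>.add ((tP.comp hW).const_mul (2 * Real.cos (7 * Real.pi / 16)))
  rw [mul_zero] at lhs
  have rhs : Tendsto (fun m : ℕ =>
      2 * Real.sin (3 * Real.pi / 16) * rotGFy ((rotStripV H (W m)).erase wOut) H IsRotBotOut y +
        2 * Real.sin (Real.pi / 16) * rotGFy ((rotStripV H (W m)).erase wOut) H IsRotBotIn y +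
        2 * Real.cos (3 * Real.pi / 16) * rotGFy ((rotStripV H (W m)).erase wOut) H (IsRotLatDart H (W m)) y +
        rotBcoeff y * rotGFy ((rotStripV H (W m)).erase wOut) H (IsRotTopDart H) y +
        2 * Real.cos (7 * Real.pi / 16) * rotGFy ((rotStripV H (W m)).erase wOut) H IsRotCloseDart y)
      atTop (𝓝 (2 * hexCriticalFugacity * Real.cos (Real.pi / 16))) :=
    tendsto_const_nhds.congr' (Eventually.of_forall fun m => (rotStrip_identityY_coeff hH (hW1 m) (hWodd m) hy).symm)
  have := tendsto_nhds_unique lhs rhs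
  linarith

/-! ### 3. Beaton's arch cut in the infinite strip (print (24)) and the one-step defect identity -/

/-- A priori bounds at `y = 1` for EVERY width (Proposition 4 on `D(H, W+1)`, all other terms `≥ 0`, and monotonicity in the width); private
twin of the `y`-weighted `rotClsY_le` (the `y = 1` classes are `rotGF`, cf. `rotGFy_one`). [cite: Beaton2014RotatedHoneycomb, Proposition 4 (arXiv v3 p. 5) and §4 (p. 17: "all bounded by this identity")] -/
private theorem rotCls_le_one {H : ℕ} (hH : 1 ≤ H) (Wd : ℕ) :
    2 * Real.sin (3 * Real.pi / 16) * rotGF ((rotStripV H Wd).erase wOut) IsRotBotOut ≤ 2 * hexCriticalFugacity * Real.cos (Real.pi / 16) ∧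
      2 * Real.sin (Real.pi / 16) * rotGF ((rotStripV H Wd).erase wOut) IsRotBotIn ≤ 2 * hexCriticalFugacity * Real.cos (Real.pi / 16) ∧
      2 * Real.cos (7 * Real.pi / 16) * rotGF ((rotStripV H Wd).erase wOut) IsRotCloseDart ≤
        2 * hexCriticalFugacity * Real.cos (Real.pi / 16) := by
  obtain ⟨cO, cI, cE, cP, cB1⟩ := rot_coeff_pos
  have hsub : (rotStripV H Wd).erase wOut ⊆ (rotStripV H (Wd + 1)).erase wOut :=
    erase_subset_erase _ (rotStripV_mono_width (Nat.le_succ Wd))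
  have e := rotStrip_identity (H := H) (Wd := Wd + 1) hH (by omega)
  have mO := rotGF_mono hsub IsRotBotOut
  have mI := rotGF_mono hsub IsRotBotIn
  have mP := rotGF_mono hsub IsRotCloseDart
  have n1 := mul_nonneg cO.le (rotGF_nonneg ((rotStripV H (Wd + 1)).erase wOut) IsRotBotOut)
  have n2 := mul_nonneg cI.le (rotGF_nonneg ((rotStripV H (Wd + 1)).erase wOut) IsRotBotIn)
  have n3 := mul_nonneg cE.le (rotGF_nonneg ((rotStripV H (Wd + 1)).erase wOut) (IsRotLatDart H (Wd + 1)))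
  have n4 := mul_nonneg (by linarith : (0 : ℝ) ≤ 2 * Real.cos (Real.pi / 16))
    (rotGF_nonneg ((rotStripV H (Wd + 1)).erase wOut) (IsRotTopDart H))
  have n5 := mul_nonneg cP.le (rotGF_nonneg ((rotStripV H (Wd + 1)).erase wOut) IsRotCloseDart)
  exact ⟨by nlinarith [mul_le_mul_of_nonneg_left mO cO.le], by nlinarith [mul_le_mul_of_nonneg_left mI cI.le],
    by nlinarith [mul_le_mul_of_nonneg_left mP cP.le]⟩

/-- The `y = 1` classes are bounded in the width (for `le_ciSup`). [cite: Beaton2014RotatedHoneycomb, §4 (arXiv v3 p. 16: bounded by the identity)] -/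
private theorem rotCls_bddAbove_one {H : ℕ} (hH : 1 ≤ H) :
    BddAbove (Set.range fun Wd : ℕ => rotGF ((rotStripV H Wd).erase wOut) IsRotBotOut) ∧
      BddAbove (Set.range fun Wd : ℕ => rotGF ((rotStripV H Wd).erase wOut) IsRotBotIn) ∧
      BddAbove (Set.range fun Wd : ℕ => rotGF ((rotStripV H Wd).erase wOut) IsRotCloseDart) := by
  obtain ⟨cO, cI, -, cP, -⟩ := rot_coeff_pos
  refine ⟨⟨2 * hexCriticalFugacity * Real.cos (Real.pi / 16) / (2 * Real.sin (3 * Real.pi / 16)), ?_⟩,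
    ⟨2 * hexCriticalFugacity * Real.cos (Real.pi / 16) / (2 * Real.sin (Real.pi / 16)), ?_⟩,
    ⟨2 * hexCriticalFugacity * Real.cos (Real.pi / 16) / (2 * Real.cos (7 * Real.pi / 16)), ?_⟩⟩
  · rintro _ ⟨Wd, rfl⟩; rw [le_div_iff₀ cO, mul_comm]; exact (rotCls_le_one hH Wd).1
  · rintro _ ⟨Wd, rfl⟩; rw [le_div_iff₀ cI, mul_comm]; exact (rotCls_le_one hH Wd).2.1
  · rintro _ ⟨Wd, rfl⟩; rw [le_div_iff₀ cP, mul_comm]; exact (rotCls_le_one hH Wd).2.2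

/-- The arch cut, passed to the width limit, for one bottom class (the engine of `rot_arch_cut_lim`).
[cite: Beaton2014RotatedHoneycomb, §4, proof of Proposition 11 (arXiv v3 p. 18: the last-contact cut, Fig. 7, and display (24))] -/
private theorem arch_cut_lim_aux {H : ℕ} (hH : 1 ≤ H) (cls : HV × HV → Prop) [DecidablePred cls] {y : ℝ} (hy : 0 < y)
    (hlt : y < rotYdagger)
    (hbdd : BddAbove (Set.range fun Wd : ℕ => rotGFy ((rotStripV (H + 1) Wd).erase wOut) (H + 1) cls y))
    (hbdd₀ : BddAbove (Set.range fun Wd : ℕ => rotGF ((rotStripV H Wd).erase wOut) cls))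
    (hcut : ∀ Wd : ℕ, rotGFy ((rotStripV (H + 1) Wd).erase wOut) (H + 1) cls y - rotGF ((rotStripV H Wd).erase wOut) cls ≤
      hexCriticalFugacity⁻¹ * rotGFy ((rotStripV (H + 1) Wd).erase wOut) (H + 1) (IsRotTopDart (H + 1)) y *
        ⨆ W : ℕ, rotStripBR H W) :
    0 ≤ (⨆ Wd : ℕ, rotGFy ((rotStripV (H + 1) Wd).erase wOut) (H + 1) cls y) -
        ⨆ Wd : ℕ, rotGF ((rotStripV H Wd).erase wOut) cls ∧
      (⨆ Wd : ℕ, rotGFy ((rotStripV (H + 1) Wd).erase wOut) (H + 1) cls y) -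
          (⨆ Wd : ℕ, rotGF ((rotStripV H Wd).erase wOut) cls) ≤
        hexCriticalFugacity⁻¹ * (⨆ Wd : ℕ, rotGFy ((rotStripV (H + 1) Wd).erase wOut) (H + 1) (IsRotTopDart (H + 1)) y) *
          ⨆ W : ℕ, rotStripBR H W := by
  obtain ⟨hbddB, -⟩ := tendsto_rotTopY_width (H := H + 1) (by omega) hy hlt
  have hS : 0 ≤ ⨆ W : ℕ, rotStripBR H W := Real.iSup_nonneg fun W => rotStripBR_nonneg H W
  have hx : 0 ≤ hexCriticalFugacity⁻¹ := inv_nonneg.2 hexCriticalFugacity_pos_lt_one.1.le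
  constructor
  · rw [sub_nonneg]
    exact ciSup_le fun Wd => (rotGF_le_rotGFy_succ le_rfl cls hy.le).trans (le_ciSup hbdd Wd)
  · rw [sub_le_iff_le_add]
    refine ciSup_le fun Wd => ?_
    have h1 := hcut Wd
    have h2 : rotGF ((rotStripV H Wd).erase wOut) cls ≤ ⨆ Wd : ℕ, rotGF ((rotStripV H Wd).erase wOut) cls := le_ciSup hbdd₀ Wd
    have h3 : rotGFy ((rotStripV (H + 1) Wd).erase wOut) (H + 1) (IsRotTopDart (H + 1)) y ≤
        ⨆ Wd : ℕ, rotGFy ((rotStripV (H + 1) Wd).erase wOut) (H + 1) (IsRotTopDart (H + 1)) y := le_ciSup hbddB Wd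
    have h4 := mul_le_mul_of_nonneg_right (mul_le_mul_of_nonneg_left h3 hx) hS
    linarith

/-- **Beaton's last-contact cut in the infinite strip (print (24), class by class), for `0 < y < y†`, `H ≥ 1`**: each arch-type class grows from
`(H, y = 1)` to `(H + 1, y)` by at least `0` and at most `x_c⁻¹ · B_{H+1}(x_c; y) · B_H(x_c; 1)`:
`0 ≤ A^O_{H+1}(x_c; y) − A^O_H(x_c; 1) ≤ x_c⁻¹ B_{H+1}(x_c; y) B_H(x_c; 1)`, and the same for `A^I` and `P` (all four quantities being width
suprema; print: "A^O_{T+1}(x,y) − A^O_T(x,1) ≤ ((1+x)/2)·B_{T+1}(x,y) B_T(x,1) ≤ B_{T+1}(x,y) B_T(x,1) … valid … for y < y_{T+1}", in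
print's symmetric normalisation; the tree's finite-width cut `rot_arch_cut_iSup` carries the constant `x_c⁻¹` against the right-started
halves).  The lower bound is inclusion of domains (`rotGF_le_rotGFy_succ`).
[cite: Beaton2014RotatedHoneycomb, §4, proof of Proposition 11 (arXiv v3 p. 18, display (24) and Fig. 7)] -/
theorem rot_arch_cut_lim {H : ℕ} (hH : 1 ≤ H) {y : ℝ} (hy : 0 < y) (hlt : y < rotYdagger) :
    (0 ≤ (⨆ Wd : ℕ, rotGFy ((rotStripV (H + 1) Wd).erase wOut) (H + 1) IsRotBotOut y) -
          ⨆ Wd : ℕ, rotGF ((rotStripV H Wd).erase wOut) IsRotBotOut ∧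
      (⨆ Wd : ℕ, rotGFy ((rotStripV (H + 1) Wd).erase wOut) (H + 1) IsRotBotOut y) -
          (⨆ Wd : ℕ, rotGF ((rotStripV H Wd).erase wOut) IsRotBotOut) ≤
        hexCriticalFugacity⁻¹ * (⨆ Wd : ℕ, rotGFy ((rotStripV (H + 1) Wd).erase wOut) (H + 1) (IsRotTopDart (H + 1)) y) *
          ⨆ W : ℕ, rotStripBR H W) ∧
    (0 ≤ (⨆ Wd : ℕ, rotGFy ((rotStripV (H + 1) Wd).erase wOut) (H + 1) IsRotBotIn y) -
          ⨆ Wd : ℕ, rotGF ((rotStripV H Wd).erase wOut) IsRotBotIn ∧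
      (⨆ Wd : ℕ, rotGFy ((rotStripV (H + 1) Wd).erase wOut) (H + 1) IsRotBotIn y) -
          (⨆ Wd : ℕ, rotGF ((rotStripV H Wd).erase wOut) IsRotBotIn) ≤
        hexCriticalFugacity⁻¹ * (⨆ Wd : ℕ, rotGFy ((rotStripV (H + 1) Wd).erase wOut) (H + 1) (IsRotTopDart (H + 1)) y) *
          ⨆ W : ℕ, rotStripBR H W) ∧
    (0 ≤ (⨆ Wd : ℕ, rotGFy ((rotStripV (H + 1) Wd).erase wOut) (H + 1) IsRotCloseDart y) -
          ⨆ Wd : ℕ, rotGF ((rotStripV H Wd).erase wOut) IsRotCloseDart ∧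
      (⨆ Wd : ℕ, rotGFy ((rotStripV (H + 1) Wd).erase wOut) (H + 1) IsRotCloseDart y) -
          (⨆ Wd : ℕ, rotGF ((rotStripV H Wd).erase wOut) IsRotCloseDart) ≤
        hexCriticalFugacity⁻¹ * (⨆ Wd : ℕ, rotGFy ((rotStripV (H + 1) Wd).erase wOut) (H + 1) (IsRotTopDart (H + 1)) y) *
          ⨆ W : ℕ, rotStripBR H W) := by
  obtain ⟨⟨bO, -⟩, ⟨bI, -⟩, ⟨bP, -⟩⟩ := tendsto_rotClsY_width (H := H + 1) (by omega) hy hlt.le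
  obtain ⟨bO₀, bI₀, bP₀⟩ := rotCls_bddAbove_one hH
  have hcut : ∀ Wd : ℕ, _ := fun Wd => by
    have h := rot_arch_cut_iSup (H := H) hH Wd hy.le
    dsimp only at h
    exact h
  exact ⟨arch_cut_lim_aux hH IsRotBotOut hy hlt bO bO₀ fun Wd => (hcut Wd).1,
    arch_cut_lim_aux hH IsRotBotIn hy hlt bI bI₀ fun Wd => (hcut Wd).2.1,
    arch_cut_lim_aux hH IsRotCloseDart hy hlt bP bP₀ fun Wd => (hcut Wd).2.2⟩

/-- **The one-step defect identity (`(H, y = 1) → (H + 1, y)`), `0 < y < y†`, `H ≥ 1`** — Beaton's "(23) to eliminate the A^O, A^I and P terms",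
kept as an EQUALITY: `2cos(π/16)·B_H(x_c; 1) − c_B(y)·B_{H+1}(x_c; y) = 2sin(3π/16)·[A^O_{H+1}(y) − A^O_H(1)] + 2sin(π/16)·[A^I_{H+1}(y) − A^I_H(1)]
+ 2cos(7π/16)·[P_{H+1}(y) − P_H(1)]` (the infinite-strip identities at `(H, 1)` — tree `rotStrip_identity_lim` — and at `(H + 1, y)` —
`rotStrip_identityY_lim` — have the same right-hand side `2 x_c cos(π/16)`).  LANE phrasing (print subtracts after bounding).
[cite: Beaton2014RotatedHoneycomb, §4, eq. (22)–(23) (arXiv v3 pp. 16–17) and the proof of Proposition 11 (p. 18: "Using (23) to eliminate the A^O, A^I and P terms")] -/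
theorem rot_one_step_defect_eq {H : ℕ} (hH : 1 ≤ H) {y : ℝ} (hy : 0 < y) (hlt : y < rotYdagger) :
    2 * Real.cos (Real.pi / 16) * (⨆ W : ℕ, rotStripBR H W) -
        rotBcoeff y * (⨆ Wd : ℕ, rotGFy ((rotStripV (H + 1) Wd).erase wOut) (H + 1) (IsRotTopDart (H + 1)) y) =
      2 * Real.sin (3 * Real.pi / 16) * ((⨆ Wd : ℕ, rotGFy ((rotStripV (H + 1) Wd).erase wOut) (H + 1) IsRotBotOut y) -
          ⨆ Wd : ℕ, rotGF ((rotStripV H Wd).erase wOut) IsRotBotOut) +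
        2 * Real.sin (Real.pi / 16) * ((⨆ Wd : ℕ, rotGFy ((rotStripV (H + 1) Wd).erase wOut) (H + 1) IsRotBotIn y) -
          ⨆ Wd : ℕ, rotGF ((rotStripV H Wd).erase wOut) IsRotBotIn) +
        2 * Real.cos (7 * Real.pi / 16) * ((⨆ Wd : ℕ, rotGFy ((rotStripV (H + 1) Wd).erase wOut) (H + 1) IsRotCloseDart y) -
          ⨆ Wd : ℕ, rotGF ((rotStripV H Wd).erase wOut) IsRotCloseDart) := by
  have h0 := rotStrip_identity_lim hH
  have h1 := rotStrip_identityY_lim (H := H + 1) (by omega) hy hlt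
  linarith

/-- **The squeeze of the one-step defect, `0 < y < y†`, `H ≥ 1`**:
`0 ≤ 2cos(π/16)·B_H(x_c; 1) − c_B(y)·B_{H+1}(x_c; y) ≤ σ x_c⁻¹ · B_{H+1}(x_c; y) · B_H(x_c; 1)`, `σ := 2sin(3π/16) + 2sin(π/16) + 2cos(7π/16)` — the
right-hand inequality is Beaton's display "c_B B_T(x,1) − c_B(y) B_{T+1}(x,y) ≤ (c^O_A + c^I_A + c_P) B_{T+1}(x,y) B_T(x,1)" AS PRINTED (in the
tree's right-started normalisation, where the cut constant is `x_c⁻¹`), now unconditional for `y < y†`; the left-hand one is the tree's upper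
half `iSup_rotTopY_succ_le` in product form.
[cite: Beaton2014RotatedHoneycomb, §4, proof of Proposition 11 (arXiv v3 p. 18: the display between (24) and (25))] -/
theorem rot_one_step_defect_bounds {H : ℕ} (hH : 1 ≤ H) {y : ℝ} (hy : 0 < y) (hlt : y < rotYdagger) :
    0 ≤ 2 * Real.cos (Real.pi / 16) * (⨆ W : ℕ, rotStripBR H W) -
        rotBcoeff y * (⨆ Wd : ℕ, rotGFy ((rotStripV (H + 1) Wd).erase wOut) (H + 1) (IsRotTopDart (H + 1)) y) ∧
      2 * Real.cos (Real.pi / 16) * (⨆ W : ℕ, rotStripBR H W) -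
          rotBcoeff y * (⨆ Wd : ℕ, rotGFy ((rotStripV (H + 1) Wd).erase wOut) (H + 1) (IsRotTopDart (H + 1)) y) ≤
        (2 * Real.sin (3 * Real.pi / 16) + 2 * Real.sin (Real.pi / 16) + 2 * Real.cos (7 * Real.pi / 16)) * hexCriticalFugacity⁻¹ *
          (⨆ Wd : ℕ, rotGFy ((rotStripV (H + 1) Wd).erase wOut) (H + 1) (IsRotTopDart (H + 1)) y) * ⨆ W : ℕ, rotStripBR H W := by
  obtain ⟨cO, cI, -, cP, -⟩ := rot_coeff_pos
  have he := rot_one_step_defect_eq hH hy hlt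
  obtain ⟨⟨lO, uO⟩, ⟨lI, uI⟩, ⟨lP, uP⟩⟩ := rot_arch_cut_lim hH hy hlt
  constructor
  · nlinarith [mul_nonneg cO.le lO, mul_nonneg cI.le lI, mul_nonneg cP.le lP]
  · nlinarith [mul_le_mul_of_nonneg_left uO cO.le, mul_le_mul_of_nonneg_left uI cI.le, mul_le_mul_of_nonneg_left uP cP.le]

/-! ### 4. The two-sided squeeze: lower half, positivity, Beaton's (25), the ratio law, its rate, the asymptotics -/

/-- **The LOWER half of the squeeze (new next to the tree's upper half `iSup_rotTopY_succ_le`), `0 < y < y†`, `H ≥ 1`**: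
`2cos(π/16)·B_H(x_c; 1) ≤ (c_B(y) + σ x_c⁻¹·B_H(x_c; 1)) · B_{H+1}(x_c; y)`, i.e. the `y`-weighted top class one row higher is bounded BELOW by
the critical top class, with a coefficient that is itself a finite-data quantity (`σ = 2sin(3π/16) + 2sin(π/16) + 2cos(7π/16)`).
[cite: Beaton2014RotatedHoneycomb, §4, proof of Proposition 11 (arXiv v3 p. 18: the display before (25))] -/
theorem two_mul_cos_mul_iSup_rotStripBR_le_mul {H : ℕ} (hH : 1 ≤ H) {y : ℝ} (hy : 0 < y) (hlt : y < rotYdagger) :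
    2 * Real.cos (Real.pi / 16) * (⨆ W : ℕ, rotStripBR H W) ≤
      (rotBcoeff y + (2 * Real.sin (3 * Real.pi / 16) + 2 * Real.sin (Real.pi / 16) + 2 * Real.cos (7 * Real.pi / 16)) *
          hexCriticalFugacity⁻¹ * ⨆ W : ℕ, rotStripBR H W) *
        ⨆ Wd : ℕ, rotGFy ((rotStripV (H + 1) Wd).erase wOut) (H + 1) (IsRotTopDart (H + 1)) y := by
  have h := (rot_one_step_defect_bounds hH hy hlt).2
  linarith

/-- **`B_{H+1}(x_c; y) > 0` with an explicit floor**, `0 < y < y†`, `H ≥ 1`: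
`2cos(π/16)·B_H(x_c;1) / (c_B(y) + σ x_c⁻¹ B_H(x_c;1)) ≤ B_{H+1}(x_c; y)` and hence `0 < B_{H+1}(x_c; y)` (tree `iSup_rotStripBR_pos`: `B_H(x_c;1) > 0`).
[cite: Beaton2014RotatedHoneycomb, §4, proof of Proposition 11 (arXiv v3 p. 18, (25): "0 ≤ 1/B_{T+1}(x,y) ≤ …")] -/
theorem iSup_rotTopY_succ_ge {H : ℕ} (hH : 1 ≤ H) {y : ℝ} (hy : 0 < y) (hlt : y < rotYdagger) :
    2 * Real.cos (Real.pi / 16) * (⨆ W : ℕ, rotStripBR H W) /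
        (rotBcoeff y + (2 * Real.sin (3 * Real.pi / 16) + 2 * Real.sin (Real.pi / 16) + 2 * Real.cos (7 * Real.pi / 16)) *
          hexCriticalFugacity⁻¹ * ⨆ W : ℕ, rotStripBR H W) ≤
      (⨆ Wd : ℕ, rotGFy ((rotStripV (H + 1) Wd).erase wOut) (H + 1) (IsRotTopDart (H + 1)) y) ∧
    0 < ⨆ Wd : ℕ, rotGFy ((rotStripV (H + 1) Wd).erase wOut) (H + 1) (IsRotTopDart (H + 1)) y := by
  obtain ⟨cO, cI, -, cP, cB1⟩ := rot_coeff_pos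
  have hx : 0 < hexCriticalFugacity⁻¹ := inv_pos.2 hexCriticalFugacity_pos_lt_one.1
  have hS := iSup_rotStripBR_pos hH
  have hc := rotBcoeff_pos hy hlt
  have hden : 0 < rotBcoeff y + (2 * Real.sin (3 * Real.pi / 16) + 2 * Real.sin (Real.pi / 16) +
      2 * Real.cos (7 * Real.pi / 16)) * hexCriticalFugacity⁻¹ * ⨆ W : ℕ, rotStripBR H W := by positivity
  have h := two_mul_cos_mul_iSup_rotStripBR_le_mul hH hy hlt
  refine ⟨by rw [div_le_iff₀ hden]; linarith, ?_⟩
  have hpos : 0 < 2 * Real.cos (Real.pi / 16) * ⨆ W : ℕ, rotStripBR H W := by nlinarith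
  exact pos_of_mul_pos_right (hpos.trans_le h) hden.le

/-- **Beaton's (25) AS PRINTED (tree normalisation), `0 < y < y†`, `H ≥ 1`**:
`0 ≤ 1/B_{H+1}(x_c; y) ≤ σ x_c⁻¹/(2cos(π/16)) + c_B(y)/(2cos(π/16)·B_H(x_c; 1))` — print: "0 ≤ 1/B_{T+1}(x,y) ≤ (c^O_A + c^I_A + c_P)/c_B +
c_B(y)/(c_B B_T(x,1))", `c_B = c_B(1) = 2cos(π/16)`.
[cite: Beaton2014RotatedHoneycomb, §4, proof of Proposition 11 (arXiv v3 p. 18, eq. (25))] -/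
theorem inv_iSup_rotTopY_succ_le {H : ℕ} (hH : 1 ≤ H) {y : ℝ} (hy : 0 < y) (hlt : y < rotYdagger) :
    0 ≤ ((⨆ Wd : ℕ, rotGFy ((rotStripV (H + 1) Wd).erase wOut) (H + 1) (IsRotTopDart (H + 1)) y))⁻¹ ∧
      ((⨆ Wd : ℕ, rotGFy ((rotStripV (H + 1) Wd).erase wOut) (H + 1) (IsRotTopDart (H + 1)) y))⁻¹ ≤
        (2 * Real.sin (3 * Real.pi / 16) + 2 * Real.sin (Real.pi / 16) + 2 * Real.cos (7 * Real.pi / 16)) * hexCriticalFugacity⁻¹ /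
            (2 * Real.cos (Real.pi / 16)) +
          rotBcoeff y / (2 * Real.cos (Real.pi / 16) * ⨆ W : ℕ, rotStripBR H W) := by
  obtain ⟨-, -, -, -, cB1⟩ := rot_coeff_pos
  obtain ⟨-, hB⟩ := iSup_rotTopY_succ_ge hH hy hlt
  have hS := iSup_rotStripBR_pos hH
  have hcos : 0 < 2 * Real.cos (Real.pi / 16) := by linarith
  have h := two_mul_cos_mul_iSup_rotStripBR_le_mul hH hy hlt
  refine ⟨inv_nonneg.2 hB.le, ?_⟩
  have hrhs : (2 * Real.sin (3 * Real.pi / 16) + 2 * Real.sin (Real.pi / 16) + 2 * Real.cos (7 * Real.pi / 16)) *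
        hexCriticalFugacity⁻¹ / (2 * Real.cos (Real.pi / 16)) + rotBcoeff y / (2 * Real.cos (Real.pi / 16) * ⨆ W : ℕ, rotStripBR H W) =
      (rotBcoeff y + (2 * Real.sin (3 * Real.pi / 16) + 2 * Real.sin (Real.pi / 16) + 2 * Real.cos (7 * Real.pi / 16)) *
          hexCriticalFugacity⁻¹ * ⨆ W : ℕ, rotStripBR H W) / (2 * Real.cos (Real.pi / 16) * ⨆ W : ℕ, rotStripBR H W) := by
    field_simp
    ring
  rw [hrhs, inv_eq_one_div, div_le_div_iff₀ hB (mul_pos hcos hS), one_mul]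
  linarith

/-- **The ratio law, lower side** (`0 < y < y†`, `H ≥ 1`): `c_B(y) ≤ 2cos(π/16)·B_H(x_c; 1)/B_{H+1}(x_c; y)` (the tree's upper half, divided).
[cite: Beaton2014RotatedHoneycomb, §4, Lemma 12 (arXiv v3 p. 17) and eq. (22)–(23) (pp. 16–17); lane corollary] -/
theorem rotBcoeff_le_ratio {H : ℕ} (hH : 1 ≤ H) {y : ℝ} (hy : 0 < y) (hlt : y < rotYdagger) :
    rotBcoeff y ≤ 2 * Real.cos (Real.pi / 16) * (⨆ W : ℕ, rotStripBR H W) /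
      ⨆ Wd : ℕ, rotGFy ((rotStripV (H + 1) Wd).erase wOut) (H + 1) (IsRotTopDart (H + 1)) y := by
  obtain ⟨-, hB⟩ := iSup_rotTopY_succ_ge hH hy hlt
  have h := (rot_one_step_defect_bounds hH hy hlt).1
  rw [le_div_iff₀ hB]
  linarith

/-- **The ratio law, upper side with the explicit error** (`0 < y < y†`, `H ≥ 1`):
`2cos(π/16)·B_H(x_c; 1)/B_{H+1}(x_c; y) ≤ c_B(y) + σ x_c⁻¹·B_H(x_c; 1)`.
[cite: Beaton2014RotatedHoneycomb, §4, proof of Proposition 11 (arXiv v3 p. 18, the display before (25)); lane corollary] -/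
theorem ratio_le_rotBcoeff_add {H : ℕ} (hH : 1 ≤ H) {y : ℝ} (hy : 0 < y) (hlt : y < rotYdagger) :
    2 * Real.cos (Real.pi / 16) * (⨆ W : ℕ, rotStripBR H W) /
        (⨆ Wd : ℕ, rotGFy ((rotStripV (H + 1) Wd).erase wOut) (H + 1) (IsRotTopDart (H + 1)) y) ≤
      rotBcoeff y + (2 * Real.sin (3 * Real.pi / 16) + 2 * Real.sin (Real.pi / 16) + 2 * Real.cos (7 * Real.pi / 16)) *
        hexCriticalFugacity⁻¹ * ⨆ W : ℕ, rotStripBR H W := by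
  obtain ⟨-, hB⟩ := iSup_rotTopY_succ_ge hH hy hlt
  have h := two_mul_cos_mul_iSup_rotStripBR_le_mul hH hy hlt
  rw [div_le_iff₀ hB]
  linarith

/-- **THE RATIO LAW WITH AN EXPLICIT ERROR (`0 < y < y†`, `H ≥ 1`)**:
`|2cos(π/16)·B_H(x_c; 1)/B_{H+1}(x_c; y) − c_B(y)| ≤ σ x_c⁻¹ · B_H(x_c; 1)` — the ratio of the critical top class to the `y`-weighted one a
row higher is `c_B(y)/(2cos(π/16))` up to an error controlled EXACTLY by the critical top class `B_H(x_c; 1)` itself (`→ 0`, Beaton App. Cor. 15;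
`≤ C (log H)^{−1/3}` in the tree).  NEW-IN-WRITING as a statement (implicit in print's (24)–(25)).
[cite: Beaton2014RotatedHoneycomb, §4, proof of Proposition 11 (arXiv v3 p. 18, (24)–(25)); lane corollary] -/
theorem abs_ratio_sub_rotBcoeff_le {H : ℕ} (hH : 1 ≤ H) {y : ℝ} (hy : 0 < y) (hlt : y < rotYdagger) :
    |2 * Real.cos (Real.pi / 16) * (⨆ W : ℕ, rotStripBR H W) /
          (⨆ Wd : ℕ, rotGFy ((rotStripV (H + 1) Wd).erase wOut) (H + 1) (IsRotTopDart (H + 1)) y) - rotBcoeff y| ≤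
      (2 * Real.sin (3 * Real.pi / 16) + 2 * Real.sin (Real.pi / 16) + 2 * Real.cos (7 * Real.pi / 16)) * hexCriticalFugacity⁻¹ *
        ⨆ W : ℕ, rotStripBR H W := by
  have h1 := rotBcoeff_le_ratio hH hy hlt
  have h2 := ratio_le_rotBcoeff_add hH hy hlt
  rw [abs_le]
  constructor <;> linarith

/-- **The ratio law at the tree's logarithmic rate**: for `0 < y < y†` there is `C` with
`|2cos(π/16)·B_H(x_c; 1)/B_{H+1}(x_c; y) − c_B(y)| ≤ C (log H)^{−1/3}` for every `H ≥ 2` (`C = σ x_c⁻¹ · C_T3`, `C_T3` the constant of the tree's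
`iSup_rotStripBR_le_log`, Beaton App. A with the Glazman–Manolescu triangle bound). [cite: Beaton2014RotatedHoneycomb, Appendix A, Corollary 15 (arXiv v3 p. 19); GlazmanManolescu2019, Proposition 1.1; lane corollary] -/
theorem abs_ratio_sub_rotBcoeff_le_log {y : ℝ} (hy : 0 < y) (hlt : y < rotYdagger) :
    ∃ C : ℝ, ∀ H : ℕ, 2 ≤ H →
      |2 * Real.cos (Real.pi / 16) * (⨆ W : ℕ, rotStripBR H W) /
            (⨆ Wd : ℕ, rotGFy ((rotStripV (H + 1) Wd).erase wOut) (H + 1) (IsRotTopDart (H + 1)) y) - rotBcoeff y| ≤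
        C * Real.log H ^ (-(1 : ℝ) / 3) := by
  obtain ⟨C, hC⟩ := iSup_rotStripBR_le_log
  obtain ⟨cO, cI, -, cP, -⟩ := rot_coeff_pos
  have hk : 0 ≤ (2 * Real.sin (3 * Real.pi / 16) + 2 * Real.sin (Real.pi / 16) + 2 * Real.cos (7 * Real.pi / 16)) *
      hexCriticalFugacity⁻¹ := mul_nonneg (by linarith) (inv_nonneg.2 hexCriticalFugacity_pos_lt_one.1.le)
  refine ⟨(2 * Real.sin (3 * Real.pi / 16) + 2 * Real.sin (Real.pi / 16) + 2 * Real.cos (7 * Real.pi / 16)) *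
      hexCriticalFugacity⁻¹ * C, fun H hH => ?_⟩
  calc _ ≤ (2 * Real.sin (3 * Real.pi / 16) + 2 * Real.sin (Real.pi / 16) + 2 * Real.cos (7 * Real.pi / 16)) * hexCriticalFugacity⁻¹ *
        ⨆ W : ℕ, rotStripBR H W := abs_ratio_sub_rotBcoeff_le (by omega) hy hlt
    _ ≤ (2 * Real.sin (3 * Real.pi / 16) + 2 * Real.sin (Real.pi / 16) + 2 * Real.cos (7 * Real.pi / 16)) * hexCriticalFugacity⁻¹ *
        (C * Real.log H ^ (-(1 : ℝ) / 3)) := mul_le_mul_of_nonneg_left (hC H hH) hk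
    _ = _ := by ring

/-- **The ratio converges: `2cos(π/16)·B_H(x_c; 1)/B_{H+1}(x_c; y) → c_B(y)` as `H → ∞`** (`0 < y < y†`) — squeeze between `rotBcoeff_le_ratio` and
`ratio_le_rotBcoeff_add`, with `B_H(x_c; 1) → 0` (tree `tendsto_iSup_rotStripBR`, Beaton App. Cor. 15).
[cite: Beaton2014RotatedHoneycomb, §4 (arXiv v3 pp. 17–18) and Appendix Corollary 15 (p. 19: B(x_c,1) = 0); lane corollary] -/
theorem tendsto_ratio_rotBcoeff {y : ℝ} (hy : 0 < y) (hlt : y < rotYdagger) :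
    Tendsto (fun H : ℕ => 2 * Real.cos (Real.pi / 16) * (⨆ W : ℕ, rotStripBR H W) /
      ⨆ Wd : ℕ, rotGFy ((rotStripV (H + 1) Wd).erase wOut) (H + 1) (IsRotTopDart (H + 1)) y) atTop (𝓝 (rotBcoeff y)) := by
  have hup : Tendsto (fun H : ℕ => rotBcoeff y + (2 * Real.sin (3 * Real.pi / 16) + 2 * Real.sin (Real.pi / 16) +
      2 * Real.cos (7 * Real.pi / 16)) * hexCriticalFugacity⁻¹ * ⨆ W : ℕ, rotStripBR H W) atTop (𝓝 (rotBcoeff y)) := by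
    have h := (tendsto_iSup_rotStripBR.const_mul ((2 * Real.sin (3 * Real.pi / 16) + 2 * Real.sin (Real.pi / 16) +
      2 * Real.cos (7 * Real.pi / 16)) * hexCriticalFugacity⁻¹)).const_add (rotBcoeff y)
    simpa using h
  refine tendsto_of_tendsto_of_tendsto_of_le_of_le' tendsto_const_nhds hup ?_ ?_
  · filter_upwards [eventually_ge_atTop 1] with H hH using rotBcoeff_le_ratio hH hy hlt
  · filter_upwards [eventually_ge_atTop 1] with H hH using ratio_le_rotBcoeff_add hH hy hlt

/-- **Asymptotic equivalence `B_{H+1}(x_c; y) ~ (2cos(π/16)/c_B(y)) · B_H(x_c; 1)` (`0 < y < y†`)**: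
`B_{H+1}(x_c; y)/B_H(x_c; 1) → 2cos(π/16)/c_B(y)` as `H → ∞` — the `y`-weighted top class a row higher vanishes at EXACTLY the rate of Beaton's
critical top class, with the printed constant. [cite: Beaton2014RotatedHoneycomb, §4, Lemma 12 and Proposition 11 (arXiv v3 pp. 17–18); lane corollary, not stated in print] -/
theorem tendsto_iSup_rotTopY_succ_div {y : ℝ} (hy : 0 < y) (hlt : y < rotYdagger) :
    Tendsto (fun H : ℕ => (⨆ Wd : ℕ, rotGFy ((rotStripV (H + 1) Wd).erase wOut) (H + 1) (IsRotTopDart (H + 1)) y) /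
      ⨆ W : ℕ, rotStripBR H W) atTop (𝓝 (2 * Real.cos (Real.pi / 16) / rotBcoeff y)) := by
  have hc := rotBcoeff_pos hy hlt
  have h := (tendsto_ratio_rotBcoeff hy hlt).inv₀ hc.ne'
  have h2 := h.const_mul (2 * Real.cos (Real.pi / 16))
  rw [← div_eq_mul_inv] at h2
  refine h2.congr' ?_
  filter_upwards [eventually_ge_atTop 1] with H hH
  have hcos : 0 < 2 * Real.cos (Real.pi / 16) := by linarith [rot_coeff_pos.2.2.2.2]
  rw [inv_div, ← mul_div_assoc, mul_div_mul_left _ _ hcos.ne']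

/-! ### 5. Locality of the arch classes across the step `(H, 1) → (H + 1, y)` -/

/-- **Locality of the arch generating functions in the surface fugacity (`0 < y < y†`)**: the weighted one-step growth
`2sin(3π/16)·[A^O_{H+1}(y) − A^O_H(1)] + 2sin(π/16)·[A^I_{H+1}(y) − A^I_H(1)] + 2cos(7π/16)·[P_{H+1}(y) − P_H(1)]` lies in
`[0, (2cos(π/16))² σ x_c⁻¹/c_B(y) · B_H(x_c; 1)²]` — quadratic in the critical top class — and tends to `0` as `H → ∞`: turning on the surface
fugacity below `y†` changes the arch classes of a high strip by `O(B_H(x_c;1)²) = O((log H)^{−2/3})` beyond their critical growth.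
[cite: Beaton2014RotatedHoneycomb, §4, proof of Proposition 11 (arXiv v3 p. 18, (24)) with Lemma 12 (p. 17); lane corollary, not stated in print] -/
theorem rot_arch_growth_le_sq {H : ℕ} (hH : 1 ≤ H) {y : ℝ} (hy : 0 < y) (hlt : y < rotYdagger) :
    0 ≤ 2 * Real.sin (3 * Real.pi / 16) * ((⨆ Wd : ℕ, rotGFy ((rotStripV (H + 1) Wd).erase wOut) (H + 1) IsRotBotOut y) -
          ⨆ Wd : ℕ, rotGF ((rotStripV H Wd).erase wOut) IsRotBotOut) +
        2 * Real.sin (Real.pi / 16) * ((⨆ Wd : ℕ, rotGFy ((rotStripV (H + 1) Wd).erase wOut) (H + 1) IsRotBotIn y) -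
          ⨆ Wd : ℕ, rotGF ((rotStripV H Wd).erase wOut) IsRotBotIn) +
        2 * Real.cos (7 * Real.pi / 16) * ((⨆ Wd : ℕ, rotGFy ((rotStripV (H + 1) Wd).erase wOut) (H + 1) IsRotCloseDart y) -
          ⨆ Wd : ℕ, rotGF ((rotStripV H Wd).erase wOut) IsRotCloseDart) ∧
    2 * Real.sin (3 * Real.pi / 16) * ((⨆ Wd : ℕ, rotGFy ((rotStripV (H + 1) Wd).erase wOut) (H + 1) IsRotBotOut y) -
          ⨆ Wd : ℕ, rotGF ((rotStripV H Wd).erase wOut) IsRotBotOut) +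
        2 * Real.sin (Real.pi / 16) * ((⨆ Wd : ℕ, rotGFy ((rotStripV (H + 1) Wd).erase wOut) (H + 1) IsRotBotIn y) -
          ⨆ Wd : ℕ, rotGF ((rotStripV H Wd).erase wOut) IsRotBotIn) +
        2 * Real.cos (7 * Real.pi / 16) * ((⨆ Wd : ℕ, rotGFy ((rotStripV (H + 1) Wd).erase wOut) (H + 1) IsRotCloseDart y) -
          ⨆ Wd : ℕ, rotGF ((rotStripV H Wd).erase wOut) IsRotCloseDart) ≤
      (2 * Real.cos (Real.pi / 16)) ^ 2 * ((2 * Real.sin (3 * Real.pi / 16) + 2 * Real.sin (Real.pi / 16) +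
          2 * Real.cos (7 * Real.pi / 16)) * hexCriticalFugacity⁻¹) / rotBcoeff y * (⨆ W : ℕ, rotStripBR H W) ^ 2 := by
  obtain ⟨cO, cI, -, cP, cB1⟩ := rot_coeff_pos
  have he := rot_one_step_defect_eq hH hy hlt
  obtain ⟨h0, h1⟩ := rot_one_step_defect_bounds hH hy hlt
  have hc := rotBcoeff_pos hy hlt
  have hS := iSup_rotStripBR_pos hH
  have hx : 0 < hexCriticalFugacity⁻¹ := inv_pos.2 hexCriticalFugacity_pos_lt_one.1
  have hB := iSup_rotTopY_succ_le hH hy hlt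
  refine ⟨by linarith, ?_⟩
  rw [← he]
  set S := ⨆ W : ℕ, rotStripBR H W
  set B := ⨆ Wd : ℕ, rotGFy ((rotStripV (H + 1) Wd).erase wOut) (H + 1) (IsRotTopDart (H + 1)) y
  set k := (2 * Real.sin (3 * Real.pi / 16) + 2 * Real.sin (Real.pi / 16) + 2 * Real.cos (7 * Real.pi / 16)) * hexCriticalFugacity⁻¹
  have hk : 0 < k := by positivity
  have hkS : 0 ≤ k * S := by positivity
  calc 2 * Real.cos (Real.pi / 16) * S - rotBcoeff y * B ≤ k * B * S := h1
    _ ≤ k * (2 * Real.cos (Real.pi / 16) / rotBcoeff y * S) * S := by nlinarith [mul_le_mul_of_nonneg_left hB hkS]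
    _ = (2 * Real.cos (Real.pi / 16)) ^ 2 * k / rotBcoeff y * S ^ 2 / (2 * Real.cos (Real.pi / 16)) := by
        field_simp
    _ ≤ (2 * Real.cos (Real.pi / 16)) ^ 2 * k / rotBcoeff y * S ^ 2 := by
        apply div_le_self (by positivity) cB1

/-- **The weighted one-step growth of the arch classes tends to `0` as `H → ∞`** (`0 < y < y†`). [cite: Beaton2014RotatedHoneycomb, §4 (arXiv v3 pp. 17–18) with Appendix Corollary 15 (p. 19); lane corollary] -/
theorem tendsto_rot_arch_growth_zero {y : ℝ} (hy : 0 < y) (hlt : y < rotYdagger) :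
    Tendsto (fun H : ℕ =>
      2 * Real.sin (3 * Real.pi / 16) * ((⨆ Wd : ℕ, rotGFy ((rotStripV (H + 1) Wd).erase wOut) (H + 1) IsRotBotOut y) -
          ⨆ Wd : ℕ, rotGF ((rotStripV H Wd).erase wOut) IsRotBotOut) +
        2 * Real.sin (Real.pi / 16) * ((⨆ Wd : ℕ, rotGFy ((rotStripV (H + 1) Wd).erase wOut) (H + 1) IsRotBotIn y) -
          ⨆ Wd : ℕ, rotGF ((rotStripV H Wd).erase wOut) IsRotBotIn) +
        2 * Real.cos (7 * Real.pi / 16) * ((⨆ Wd : ℕ, rotGFy ((rotStripV (H + 1) Wd).erase wOut) (H + 1) IsRotCloseDart y) -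
          ⨆ Wd : ℕ, rotGF ((rotStripV H Wd).erase wOut) IsRotCloseDart)) atTop (𝓝 0) := by
  set c := (2 * Real.cos (Real.pi / 16)) ^ 2 * ((2 * Real.sin (3 * Real.pi / 16) + 2 * Real.sin (Real.pi / 16) +
    2 * Real.cos (7 * Real.pi / 16)) * hexCriticalFugacity⁻¹) / rotBcoeff y with hcdef
  have hsq : Tendsto (fun H : ℕ => c * (⨆ W : ℕ, rotStripBR H W) ^ 2) atTop (𝓝 0) := by
    have h := (tendsto_iSup_rotStripBR.pow 2).const_mul c
    simpa using h
  refine squeeze_zero' ?_ ?_ hsq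
  · filter_upwards [eventually_ge_atTop 1] with H hH using (rot_arch_growth_le_sq hH hy hlt).1
  · filter_upwards [eventually_ge_atTop 1] with H hH using (rot_arch_growth_le_sq hH hy hlt).2

/-! ### 6. AT the critical surface fugacity: the top class does not vanish — a jump across `y†` at every height -/

/-- `x_c > 0.54119` (`x_c = 1/√(2+√2) = 0.541196…`). [cite: DuminilCopinSmirnov2012, Theorem 1 (μ = √(2+√2))] -/
private theorem hexCriticalFugacity_gt' : (0.54119 : ℝ) < hexCriticalFugacity := by
  have hx : 0 < hexCriticalFugacity := hexCriticalFugacity_pos_lt_one.1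
  have h2 : Real.sqrt 2 < 1.414214 := by
    rw [show (1.414214 : ℝ) = Real.sqrt (1.414214 ^ 2) by rw [Real.sqrt_sq]; norm_num]
    exact Real.sqrt_lt_sqrt (by norm_num) (by norm_num)
  have hsq := hexCriticalFugacity_sq
  nlinarith [sq_nonneg (hexCriticalFugacity - 0.54119), sq_nonneg (hexCriticalFugacity + 0.54119), Real.sqrt_nonneg 2]

/-- **The jump constant is `> 1/2`**: `j₀ := 2cos(π/16)·x_c/σ > 1/2`, i.e. `σ < 4cos(π/16)·x_c` (`σ = 2sin(3π/16) + 2sin(π/16) + 2cos(7π/16)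
≤ 10π/16 < 1.97` by `sin t ≤ t` and `cos(7π/16) = sin(π/16)`; `2cos(π/16) ≥ 2 − (π/16)² > 1.96`; `x_c > 0.5411`; numerically `j₀ = 0.5612…`).
[cite: Beaton2014RotatedHoneycomb, §2.2, Proposition 4, eq. (5) (arXiv v3 pp. 5–6: the coefficients); folklore numerics] -/
theorem rot_jump_const_gt_half :
    (1 / 2 : ℝ) < 2 * Real.cos (Real.pi / 16) * hexCriticalFugacity /
      (2 * Real.sin (3 * Real.pi / 16) + 2 * Real.sin (Real.pi / 16) + 2 * Real.cos (7 * Real.pi / 16)) := by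
  obtain ⟨cO, cI, -, cP, -⟩ := rot_coeff_pos
  have hpi := Real.pi_lt_d2
  have hpi0 := Real.pi_pos
  have hx := hexCriticalFugacity_gt'
  have h7 : Real.cos (7 * Real.pi / 16) = Real.sin (Real.pi / 16) := by
    rw [← Real.sin_pi_div_two_sub]; congr 1; ring
  have hs3 : Real.sin (3 * Real.pi / 16) ≤ 3 * Real.pi / 16 := Real.sin_le (by positivity)
  have hs1 : Real.sin (Real.pi / 16) ≤ Real.pi / 16 := Real.sin_le (by positivity)
  have hc1 : 1 - (Real.pi / 16) ^ 2 / 2 ≤ Real.cos (Real.pi / 16) := Real.one_sub_sq_div_two_le_cos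
  have hpi2 : Real.pi ^ 2 < 3.15 ^ 2 := by nlinarith
  have hc1' : (0.98 : ℝ) ≤ Real.cos (Real.pi / 16) := by nlinarith
  have hprod : (0.98 : ℝ) * 0.54119 ≤ Real.cos (Real.pi / 16) * hexCriticalFugacity :=
    mul_le_mul hc1' hx.le (by norm_num) (by linarith)
  have hden : 0 < 2 * Real.sin (3 * Real.pi / 16) + 2 * Real.sin (Real.pi / 16) + 2 * Real.cos (7 * Real.pi / 16) := by linarith
  rw [lt_div_iff₀ hden, h7]
  nlinarith

/-- **THE JUMP AT `y†` (no hypothesis; every height `H ≥ 1`)**: for every `j < j₀ := 2cos(π/16)·x_c/σ` some width `W` has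
`j < B^{→}_{H+1,W}(x_c; y†)`.  Proof: for `y < y†`, `B_{H+1}(x_c; y) ≥ 2cos(π/16) B_H(x_c;1)/(c_B(y) + σ x_c⁻¹ B_H(x_c;1))` (§ 4), whose limit as
`y ↑ y†` is `2cos(π/16) x_c/σ = j₀` because `c_B(y) → c_B(y†) = 0`; and `B^{→}_{H+1,W}(x_c; ·)` is non-decreasing in `y`.  Contrast: for every
`y < y†`, `sup_W B^{→}_{H,W}(x_c; y) → 0` as `H → ∞` (tree `tendsto_iSup_rotTopY_zero`) — AT `y†` the `y`-weighted top class keeps mass `≥ j₀ > 1/2`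
at every height (possibly `+∞`: no finiteness of `sup_W B^{→}_{H+1,W}(x_c; y†)` is claimed or used).  In print the corresponding reading of (25) at
`y = y†` would need `y† < y_{T+1}` STRICTLY (the domain of convergence); this statement sidesteps the strictness.  NEW-IN-WRITING (S).
[cite: Beaton2014RotatedHoneycomb, §4, proof of Proposition 11 (arXiv v3 p. 18, (25)–(26)) and p. 16 ("c_B(y†) = 0"); lane corollary, not stated in print] -/
theorem exists_lt_rotTopY_succ_rotYdagger {H : ℕ} (hH : 1 ≤ H) {j : ℝ}
    (hj : j < 2 * Real.cos (Real.pi / 16) * hexCriticalFugacity /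
      (2 * Real.sin (3 * Real.pi / 16) + 2 * Real.sin (Real.pi / 16) + 2 * Real.cos (7 * Real.pi / 16))) :
    ∃ Wd : ℕ, j < rotGFy ((rotStripV (H + 1) Wd).erase wOut) (H + 1) (IsRotTopDart (H + 1)) rotYdagger := by
  obtain ⟨cO, cI, -, cP, cB1⟩ := rot_coeff_pos
  have hx0 : 0 < hexCriticalFugacity := hexCriticalFugacity_pos_lt_one.1
  have hx : 0 < hexCriticalFugacity⁻¹ := inv_pos.2 hx0
  have hS := iSup_rotStripBR_pos hH
  set S := ⨆ W : ℕ, rotStripBR H W with hSdef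
  set k₀ := 2 * Real.sin (3 * Real.pi / 16) + 2 * Real.sin (Real.pi / 16) + 2 * Real.cos (7 * Real.pi / 16) with hk₀
  have hk₀pos : 0 < k₀ := by positivity
  -- Step 1: a fugacity `y ∈ (0, y†)` at which `2cos(π/16)·S > j·(c_B(y) + σ x_c⁻¹ S)`
  obtain ⟨y, hy0, hylt, hysmall⟩ : ∃ y : ℝ, 0 < y ∧ y < rotYdagger ∧
      j * (rotBcoeff y + k₀ * hexCriticalFugacity⁻¹ * S) < 2 * Real.cos (Real.pi / 16) * S := by
    rcases le_or_gt j 0 with hj0 | hj0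
    · have hyd := rotYdagger_pos
      refine ⟨rotYdagger / 2, half_pos hyd, half_lt_self hyd, ?_⟩
      have hc := rotBcoeff_pos (half_pos hyd) (half_lt_self hyd)
      have hden' : 0 < rotBcoeff (rotYdagger / 2) + k₀ * hexCriticalFugacity⁻¹ * S := by positivity
      have hcS : 0 < 2 * Real.cos (Real.pi / 16) * S := mul_pos (by linarith) hS
      nlinarith [mul_nonneg (neg_nonneg.2 hj0) hden'.le]
    · -- `j σ x_c⁻¹ < 2cos(π/16)` is `j < j₀`
      have hgap : j * (k₀ * hexCriticalFugacity⁻¹) < 2 * Real.cos (Real.pi / 16) := by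
        rw [lt_div_iff₀ hk₀pos] at hj
        have : j * (k₀ * hexCriticalFugacity⁻¹) * hexCriticalFugacity = j * k₀ := by field_simp
        nlinarith
      -- `η := S (2cos(π/16) − j σ x_c⁻¹)/j > 0`; `c_B(y) < η` eventually as `y ↑ y†`
      have hη : 0 < S * (2 * Real.cos (Real.pi / 16) - j * (k₀ * hexCriticalFugacity⁻¹)) / j := by
        apply div_pos (mul_pos hS (by linarith)) hj0
      have hev : ∀ᶠ y : ℝ in 𝓝[<] rotYdagger,
          rotBcoeff y < S * (2 * Real.cos (Real.pi / 16) - j * (k₀ * hexCriticalFugacity⁻¹)) / j ∧ 0 < y ∧ y < rotYdagger := by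
        refine ((tendsto_order.1 tendsto_rotBcoeff_rotYdagger).2 _ hη).and
          (((lt_mem_nhds rotYdagger_pos).filter_mono nhdsWithin_le_nhds).and ?_)
        exact eventually_nhdsWithin_of_forall fun y hy => hy
      obtain ⟨y, hyc, hy0, hylt⟩ := hev.exists
      refine ⟨y, hy0, hylt, ?_⟩
      rw [lt_div_iff₀ hj0] at hyc
      nlinarith
  -- Step 2: at that `y`, the lower half of the squeeze forces `j < B_{H+1}(x_c; y)`
  have hlow := two_mul_cos_mul_iSup_rotStripBR_le_mul hH hy0 hylt
  rw [← hSdef, ← hk₀] at hlow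
  have hden : 0 < rotBcoeff y + k₀ * hexCriticalFugacity⁻¹ * S := by
    have := rotBcoeff_pos hy0 hylt; positivity
  have hjB : j < ⨆ Wd : ℕ, rotGFy ((rotStripV (H + 1) Wd).erase wOut) (H + 1) (IsRotTopDart (H + 1)) y := by
    by_contra hle
    rw [not_lt] at hle
    have := mul_le_mul_of_nonneg_left hle hden.le
    nlinarith
  -- Step 3: some width realises it, and the top class is non-decreasing in `y`
  obtain ⟨Wd, hWd⟩ := exists_lt_of_lt_ciSup hjB
  exact ⟨Wd, hWd.trans_le (rotGFy_mono_y _ _ _ hy0.le hylt.le)⟩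

/-- **At the critical fugacity the top class exceeds `1/2` at every height**: for every `H ≥ 1` some width `W` has
`1/2 < B^{→}_{H+1,W}(x_c; y†)`. [cite: Beaton2014RotatedHoneycomb, §4, proof of Proposition 11 (arXiv v3 p. 18, (25)); lane corollary, not stated in print] -/
theorem exists_half_lt_rotTopY_succ_rotYdagger {H : ℕ} (hH : 1 ≤ H) :
    ∃ Wd : ℕ, (1 / 2 : ℝ) < rotGFy ((rotStripV (H + 1) Wd).erase wOut) (H + 1) (IsRotTopDart (H + 1)) rotYdagger :=
  exists_lt_rotTopY_succ_rotYdagger hH rot_jump_const_gt_half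

/-- **The jump across `y†`, both sides in one statement.**  BELOW: for `0 < y < y†` and `ε > 0`, for all large `H` EVERY width has
`B^{→}_{H,W}(x_c; y) < ε` (tree `tendsto_iSup_rotTopY_zero` with `rotGFy_top_le`).  AT `y†`: for EVERY `H ≥ 2` SOME width has `B^{→}_{H,W}(x_c; y†) > 1/2`.
(ABOVE `y†` the widths are unbounded for large `H` — tree `rotTop_not_bddAbove_of_gt`, Proposition 11.)
[cite: Beaton2014RotatedHoneycomb, §4, Lemma 12 and Proposition 11 (arXiv v3 pp. 17–18); lane corollary, not stated in print] -/
theorem rotTopY_jump_at_rotYdagger :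
    (∀ y : ℝ, 0 < y → y < rotYdagger → ∀ ε : ℝ, 0 < ε → ∀ᶠ H : ℕ in atTop, ∀ Wd : ℕ,
        rotGFy ((rotStripV H Wd).erase wOut) H (IsRotTopDart H) y < ε) ∧
    (∀ H : ℕ, 2 ≤ H → ∃ Wd : ℕ, (1 / 2 : ℝ) < rotGFy ((rotStripV H Wd).erase wOut) H (IsRotTopDart H) rotYdagger) := by
  constructor
  · intro y hy hlt ε hε
    have h := (tendsto_order.1 (tendsto_iSup_rotTopY_zero hy hlt)).2 ε hε
    filter_upwards [h, eventually_ge_atTop 1] with H hH hH1 Wd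
    exact (le_ciSup (tendsto_rotTopY_width hH1 hy hlt).1 Wd).trans_lt hH
  · intro H hH
    obtain ⟨H', rfl⟩ : ∃ H', H = H' + 1 := ⟨H - 1, by omega⟩
    exact exists_half_lt_rotTopY_succ_rotYdagger (by omega)

end Literature.Probability.RandomPlanarGeometry.SAW.HV
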